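import Summits.HubbardSuperconductivity.HubbardSuperconductivity.Theorems.LevyLogBootstrapBlock2InfDivXXZStubTransverseKernelPos
import Literature.MathematicalPhysics.QuantumLattice.LiebMattisMatrixElements
import Literature.Probability.LatticeModels.MedialPerturbation
import HarnessLib

/-!
# Crude floor, part 1: spin-½ entries of `H_G(Δ)` and the hop amplitude `½`

Crux `LevyTransport` (stmt-HubbardSuperconductivity-15049, route `LevyLogBootstrap`), input (c) of
the load-bearing stub `stub_logBootstrap` (`Cruxes/LevyTransport/Lines/birth.lean`): the M-UNIFORM
ANCHOR of the Lévy mass at the KLS point `Δ = 0`. The anchor is proved WITHOUT reflection positivity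
from long-range order + the `T = 0` infrared bound + a crude Perron–Frobenius floor; this file is one
link of that chain (files `…LevyTransportCrudeFloorHops`, `…RowSums`, `…Periodic`, `…Variational`,
`…CrudeFloor`, `…AnchorBlocks`, `…AnchorXY`). Model: `H_G(Δ) = xxzHamiltonian 1 G (-1) Δ`
(hard-core bosons; spin ½, label `0` = up = particle), on the torus `G = torusGraph 2 M`.
Sources: H. Tasaki, *Physics and Mathematics of Quantum Many-Body Systems* (2020) §2.4;
E. Lieb, D. Mattis, J. Math. Phys. 3 (1962) 749; T. Kennedy, E. H. Lieb, B. S. Shastry,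
Phys. Rev. Lett. 61 (1988) 2582. No definition is introduced; sorry-free.

This file: explicit spin-½ matrix elements (`spinRaise_one_apply`, …), the action of two-site
operators (`twoSite_mulVec_apply`, `raiseLower_mulVec_apply`, `raiseLower_expect_eq_sum`,
`spinDot_one_mulVec_const`), the entries of `H_G(Δ)` at zero field (`ham_entries`,
`ham_eq_neg_heis_add_diagonal`, `abs_re_ham_diag_le`) and the hop amplitude
`half_le_re_heis_of_hop` (registered torus form `crudeFloor_hopAmplitude_torus`).
-/

noncomputable section

set_option linter.dupNamespace false

namespace Summit.HubbardSuperconductivity.HubbardSuperconductivity.Theorems.LevyLogBootstrap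

open scoped BigOperators Matrix ComplexOrder
open Matrix Finset Complex
open Literature.MathematicalPhysics.QuantumLattice Literature.Probability.LatticeModels
open Literature.MathematicalPhysics.QuantumLattice.LiebMattis
open Summit.AtomisticToContinuum.BoseEinsteinCondensation.Theorems.BECStronglyRayleighSectorPerron
open Summit.HubbardSuperconductivity.HubbardSuperconductivity.Theorems.PolyaSchurPairBoson

namespace CrudeFloor

variable {Λ : Type*} [Fintype Λ] [DecidableEq Λ]

/-! ### Spin-½ entries -/

/-- Spin ½: `⟨k| S⁺ |l⟩ = 1` if `(k, l) = (0, 1)` and `0` otherwise. Tasaki (2020) §2.1,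
eq. (2.1.6). [folklore] -/
theorem spinRaise_one_apply (k l : Fin 2) :
    spinRaise 1 k l = if (k = 0 ∧ l = 1) then 1 else 0 := by
  rw [spinRaise_apply]
  fin_cases k <;> fin_cases l <;> simp

/-- Spin ½: `⟨k| S⁻ |l⟩ = 1` if `(k, l) = (1, 0)` and `0` otherwise. Tasaki (2020) §2.1,
eq. (2.1.6). [folklore] -/
theorem spinLower_one_apply (k l : Fin 2) :
    spinLower 1 k l = if (k = 1 ∧ l = 0) then 1 else 0 := by
  rw [spinLower_apply]
  fin_cases k <;> fin_cases l <;> simp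

/-- Spin ½: `⟨k| Sᶻ |l⟩ = δ_{kl} (½ - k)`. Tasaki (2020) §2.1, eq. (2.1.5). [folklore] -/
theorem spinZ_one_apply (k l : Fin 2) :
    SpinOperators.spinZ 1 k l = if k = l then (1 / 2 : ℂ) - (k.val : ℂ) else 0 := by
  rw [spinZ_apply]
  split_ifs <;> simp


/-- **Action of a two-site product operator** (`x ≠ y`):
`((a_x b_y) φ)(σ) = Σ_{l,l'} a_{σ_x l} b_{σ_y l'} φ(σ[x ↦ l][y ↦ l'])`. [folklore] -/
theorem twoSite_mulVec_apply {q : ℕ} {x y : Λ} (hxy : x ≠ y) (a b : Matrix (Fin q) (Fin q) ℂ)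
    (φ : TensorIndex Λ q → ℂ) (σ : TensorIndex Λ q) :
    ((onSite x a * onSite y b : Op Λ q) *ᵥ φ) σ =
      ∑ l : Fin q, ∑ l' : Fin q,
        a (σ x) l * b (σ y) l' * φ (Function.update (Function.update σ x l) y l') := by
  rw [← Matrix.mulVec_mulVec, onSite_mulVec_apply]
  refine Finset.sum_congr rfl fun l _ => ?_
  rw [onSite_mulVec_apply, Function.update_of_ne hxy.symm, Finset.mul_sum]
  refine Finset.sum_congr rfl fun l' _ => ?_
  ring

/-- **Action of `S⁺_x S⁻_y` (spin ½, `x ≠ y`)**: `(S⁺_x S⁻_y φ)(σ) = φ(σ[x ↦ 1][y ↦ 0])` if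
`σ_x = 0`, `σ_y = 1`, and `0` otherwise. [folklore] -/
theorem raiseLower_mulVec_apply {x y : Λ} (hxy : x ≠ y) (φ : TensorIndex Λ 2 → ℂ)
    (σ : TensorIndex Λ 2) :
    ((onSite x (spinRaise 1) * onSite y (spinLower 1) : Op Λ 2) *ᵥ φ) σ =
      if (σ x = 0 ∧ σ y = 1) then φ (Function.update (Function.update σ x 1) y 0) else 0 := by
  rw [twoSite_mulVec_apply hxy]
  simp only [spinRaise_one_apply, spinLower_one_apply]
  rcases fin_two_eq_zero_or_one (σ x) with hx | hx <;>
    rcases fin_two_eq_zero_or_one (σ y) with hy | hy <;> simp [hx, hy]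

/-- **The transverse kernel as a sum over configurations** (spin ½, `x ≠ y`):
`⟨φ, S⁺_x S⁻_y φ⟩ = Σ_{σ : σ_x = 0, σ_y = 1} conj φ(σ) · φ(σ[x ↦ 1][y ↦ 0])`. [folklore] -/
theorem raiseLower_expect_eq_sum {x y : Λ} (hxy : x ≠ y) (φ : TensorIndex Λ 2 → ℂ) :
    star φ ⬝ᵥ ((onSite x (spinRaise 1) * onSite y (spinLower 1) : Op Λ 2) *ᵥ φ) =
      ∑ σ : TensorIndex Λ 2, if (σ x = 0 ∧ σ y = 1) then
        star (φ σ) * φ (Function.update (Function.update σ x 1) y 0) else 0 := by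
  rw [dotProduct]
  refine Finset.sum_congr rfl fun σ _ => ?_
  rw [Pi.star_apply, raiseLower_mulVec_apply hxy]
  split_ifs <;> simp

/-- **Row sums of `𝐒_x · 𝐒_y` for spin ½ are `¼`**: `(𝐒_x · 𝐒_y) 𝟙 = ¼ 𝟙` (`x ≠ y`), the
all-ones vector being the fully `x`-polarised (maximal total spin) state. [folklore] -/
theorem spinDot_one_mulVec_const {x y : Λ} (hxy : x ≠ y) (σ : TensorIndex Λ 2) :
    ((spinDot 1 x y : Op Λ 2) *ᵥ fun _ => (1 : ℂ)) σ = 1 / 4 := by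
  rw [spinDot_eq_of_ne 1 hxy, Matrix.add_mulVec, Matrix.smul_mulVec, Matrix.add_mulVec]
  simp only [Pi.add_apply, Pi.smul_apply, smul_eq_mul]
  rw [twoSite_mulVec_apply hxy, twoSite_mulVec_apply hxy, twoSite_mulVec_apply hxy]
  simp only [spinRaise_one_apply, spinLower_one_apply, spinZ_one_apply, mul_one]
  rcases fin_two_eq_zero_or_one (σ x) with hx | hx <;>
    rcases fin_two_eq_zero_or_one (σ y) with hy | hy <;> simp [hx, hy] <;> norm_num

omit [Fintype Λ] in
/-- Updating a configuration at a site with the value it already has does nothing. [folklore] -/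
theorem update_eq_of_apply_eq {q : ℕ} {σ : TensorIndex Λ q} {z : Λ} {v : Fin q} (h : σ z = v) :
    Function.update σ z v = σ := by
  rw [← h]
  exact Function.update_eq_self z σ

/-! ### Entries of `H_G(Δ) = xxzHamiltonian 1 G (-1) Δ` (hard-core bosons, zero field) -/

section Ham

variable (G : SimpleGraph Λ) [DecidableRel G.Adj] (Δ : ℝ)

/-- Off the diagonal `H_G(Δ)` is minus the antiferromagnetic Heisenberg matrix (`-½` per hop);
its entries are real. (`leadPF_entries` at zero field.) [folklore] -/
theorem ham_entries :
    (∀ σ τ : TensorIndex Λ 2, σ ≠ τ →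
      (xxzHamiltonian 1 G (-1) Δ : Op Λ 2) σ τ = -(heisenbergHamiltonian 1 G 1 σ τ)) ∧
    (∀ σ τ : TensorIndex Λ 2,
      star ((xxzHamiltonian 1 G (-1) Δ : Op Λ 2) σ τ) = (xxzHamiltonian 1 G (-1) Δ : Op Λ 2) σ τ) ∧
    (∀ σ τ : TensorIndex Λ 2,
      (xxzHamiltonian 1 G (-1) Δ : Op Λ 2) σ τ = (xxzHamiltonian 1 G (-1) Δ : Op Λ 2) τ σ) ∧
    (∀ σ τ : TensorIndex Λ 2, σ ≠ τ → ((xxzHamiltonian 1 G (-1) Δ : Op Λ 2) σ τ).re ≤ 0) := by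
  have hent :=
    Summit.AtomisticToContinuum.BoseEinsteinCondensation.Cruxes.GroundStateStability.StableConeVariationalSelection.leadPF_entries
      G Δ (fun _ => (0 : ℝ))
  simp only [Complex.ofReal_zero, zero_smul, Finset.sum_const_zero, add_zero] at hent
  obtain ⟨happ, hreal, hsymm, hoff, -⟩ := hent
  exact ⟨happ, hreal, hsymm, hoff⟩

/-- The diagonal part of `H_G(Δ)`: `H = -H_Heis(J=1) + diag((1-Δ) Σ_{xy ∈ E} (½-σ_x)(½-σ_y))`
(`leadPF_ham_eq` at zero field). [folklore] -/
theorem ham_eq_neg_heis_add_diagonal :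
    (xxzHamiltonian 1 G (-1) Δ : Op Λ 2) =
      -(heisenbergHamiltonian 1 G 1) +
        diagonal fun σ => (((1 - Δ) * ∑ e ∈ G.edgeFinset,
            Sym2.lift ⟨fun x y => ((1 : ℝ) / 2 - (σ x : ℕ)) * ((1 : ℝ) / 2 - (σ y : ℕ)),
              fun _ _ => mul_comm _ _⟩ e : ℝ) : ℂ) := by
  have hd :=
    Summit.AtomisticToContinuum.BoseEinsteinCondensation.Cruxes.GroundStateStability.StableConeVariationalSelection.leadPF_ham_eq
      G Δ (fun _ => (0 : ℝ))
  simp only [Complex.ofReal_zero, zero_smul, Finset.sum_const_zero, add_zero, zero_mul] at hd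
  exact hd

omit [DecidableEq Λ] in
/-- The Ising sum over edges is bounded by `|E(G)|/4`: `|Σ_{xy∈E} (½-σ_x)(½-σ_y)| ≤ |E(G)|/4`
(each factor is `±½`). [folklore] -/
theorem abs_isingSum_le (σ : TensorIndex Λ 2) :
    |∑ e ∈ G.edgeFinset,
        Sym2.lift ⟨fun x y => ((1 : ℝ) / 2 - (σ x : ℕ)) * ((1 : ℝ) / 2 - (σ y : ℕ)),
          fun _ _ => mul_comm _ _⟩ e| ≤ (G.edgeFinset.card : ℝ) / 4 := by
  have hterm : ∀ e ∈ G.edgeFinset,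
      |Sym2.lift ⟨fun x y => ((1 : ℝ) / 2 - (σ x : ℕ)) * ((1 : ℝ) / 2 - (σ y : ℕ)),
          fun _ _ => mul_comm _ _⟩ e| ≤ 1 / 4 := by
    intro e _
    induction e using Sym2.ind with
    | h x y =>
      simp only [Sym2.lift_mk]
      rcases fin_two_eq_zero_or_one (σ x) with hx | hx <;>
        rcases fin_two_eq_zero_or_one (σ y) with hy | hy <;> simp [hx, hy] <;> norm_num
  calc |∑ e ∈ G.edgeFinset, Sym2.lift ⟨fun x y => ((1 : ℝ) / 2 - (σ x : ℕ)) * ((1 : ℝ) / 2 - (σ y : ℕ)),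
          fun _ _ => mul_comm _ _⟩ e|
      ≤ ∑ e ∈ G.edgeFinset, |Sym2.lift ⟨fun x y => ((1 : ℝ) / 2 - (σ x : ℕ)) * ((1 : ℝ) / 2 - (σ y : ℕ)),
          fun _ _ => mul_comm _ _⟩ e| := Finset.abs_sum_le_sum_abs _ _
    _ ≤ ∑ _e ∈ G.edgeFinset, (1 / 4 : ℝ) := Finset.sum_le_sum hterm
    _ = (G.edgeFinset.card : ℝ) / 4 := by rw [Finset.sum_const, nsmul_eq_mul]; ring

/-- **Diagonal entries of `H_G(Δ)`**: `H_{σσ} = -Δ Σ_{xy∈E} (½-σ_x)(½-σ_y)`, hence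
`|H_{σσ}| ≤ |Δ|·|E(G)|/4`. [folklore] -/
theorem abs_re_ham_diag_le (σ : TensorIndex Λ 2) :
    |((xxzHamiltonian 1 G (-1) Δ : Op Λ 2) σ σ).re| ≤ |Δ| * (G.edgeFinset.card : ℝ) / 4 := by
  set S : ℝ := ∑ e ∈ G.edgeFinset,
    Sym2.lift ⟨fun x y => ((1 : ℝ) / 2 - (σ x : ℕ)) * ((1 : ℝ) / 2 - (σ y : ℕ)),
      fun _ _ => mul_comm _ _⟩ e with hS
  have hheis : (heisenbergHamiltonian 1 G 1 σ σ : ℂ) = ((S : ℝ) : ℂ) := by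
    rw [heisenbergHamiltonian_apply, hS]
    push_cast
    rw [one_mul]
    refine Finset.sum_congr rfl fun e he => ?_
    induction e using Sym2.ind with
    | h x y =>
      have hxy : x ≠ y := by
        rw [SimpleGraph.mem_edgeFinset, SimpleGraph.mem_edgeSet] at he
        exact he.ne
      rw [spinDotSym_mk, spinDot_apply_self 1 hxy, Sym2.lift_mk]
      push_cast
      ring
  have hdiag : ((xxzHamiltonian 1 G (-1) Δ : Op Λ 2) σ σ).re = -Δ * S := by
    rw [ham_eq_neg_heis_add_diagonal G Δ, Matrix.add_apply, Matrix.neg_apply, diagonal_apply_eq,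
      hheis, ← hS]
    push_cast
    simp only [Complex.add_re, Complex.neg_re, Complex.ofReal_re, Complex.mul_re, Complex.sub_re,
      Complex.one_re, Complex.ofReal_im, Complex.sub_im, Complex.one_im, mul_zero, sub_zero]
    ring
  rw [hdiag, abs_mul, abs_neg]
  have := abs_isingSum_le G σ
  rw [← hS] at this
  calc |Δ| * |S| ≤ |Δ| * ((G.edgeFinset.card : ℝ) / 4) := mul_le_mul_of_nonneg_left this (abs_nonneg _)
    _ = |Δ| * (G.edgeFinset.card : ℝ) / 4 := by ring

/-- **A hop has amplitude `½`** (spin ½): for an edge `{x, y}` and `σ_x = 0`, `σ_y = 1`,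
`Re ⟨σ| H_Heis |σ[x↦1][y↦0]⟩ ≥ ½` (the edge term is exactly `½`, the others are `≥ 0`).
Tasaki (2020) §2.4, proof of Thm 2.3. [folklore] -/
theorem half_le_re_heis_of_hop {x y : Λ} (hadj : G.Adj x y) {σ : TensorIndex Λ 2}
    (hx : σ x = 0) (hy : σ y = 1) :
    (1 / 2 : ℝ) ≤ (heisenbergHamiltonian 1 G 1 σ (Function.update (Function.update σ x 1) y 0)).re := by
  set τ : TensorIndex Λ 2 := Function.update (Function.update σ x 1) y 0 with hτ
  have hxy : x ≠ y := hadj.ne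
  have hτx : τ x = 1 := by rw [hτ, Function.update_of_ne hxy, Function.update_self]
  have hτy : τ y = 0 := by rw [hτ, Function.update_self]
  have hστ : σ ≠ τ := fun h => by
    have := congrFun h y
    rw [hy, hτy] at this
    exact absurd this (by decide)
  have hrest : ∀ z, z ≠ x → z ≠ y → σ z = τ z := fun z hzx hzy => by
    rw [hτ, Function.update_of_ne hzy, Function.update_of_ne hzx]
  have hedge : spinDot 1 x y σ τ = 1 / 2 := by
    rw [spinDot_apply_of_ne 1 hxy hστ, if_pos hrest, hx, hy, hτx, hτy, spinRaise_one_apply,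
      spinLower_one_apply, spinLower_one_apply, spinRaise_one_apply]
    simp
  have he : s(x, y) ∈ G.edgeFinset := by
    rw [SimpleGraph.mem_edgeFinset, SimpleGraph.mem_edgeSet]; exact hadj
  have hterm : ∀ e ∈ G.edgeFinset, 0 ≤ (spinDotSym 1 e σ τ).re := by
    intro e he'
    obtain ⟨t, ht, ht0⟩ := spinDotSym_apply_eq_real 1 G he' σ τ
    rw [ht, Complex.ofReal_re]
    exact ht0 hστ
  rw [heisenbergHamiltonian_apply, Complex.ofReal_one, one_mul, Complex.re_sum]
  refine le_trans ?_ (Finset.single_le_sum hterm he)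
  rw [spinDotSym_mk, hedge]
  norm_num

/-- **Registered form (torus)** of `half_le_re_heis_of_hop`: on the `M × M` torus a hop across an
edge has Heisenberg amplitude `≥ ½` (spin ½). [folklore] -/
theorem crudeFloor_hopAmplitude_torus :
    ∀ (M : ℕ) [NeZero M] (x y : TorusSite 2 M), (torusGraph 2 M).Adj x y →
      ∀ σ : TensorIndex (TorusSite 2 M) 2, σ x = 0 → σ y = 1 →
        (1 / 2 : ℝ) ≤ (heisenbergHamiltonian 1 (torusGraph 2 M) 1 σ
          (Function.update (Function.update σ x 1) y 0)).re :=
  fun M _ _ _ hadj _ hx hy => half_le_re_heis_of_hop (torusGraph 2 M) hadj hx hy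


end Ham

end CrudeFloor

end Summit.HubbardSuperconductivity.HubbardSuperconductivity.Theorems.LevyLogBootstrap

end
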